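import Summits.BirchSwinnertonDyer.BirchSwinnertonDyer.Theorems.ClassRecordThreeCornerAtThreeKolyvagin

/-!
# Route `ClassRecordThree` (rung K2@3), crux 7 `CornerAtThree` (item 19111): the KOLYVAGIN ROAD on the
# non-surjective corner at `3`, file 2/3 — the corner's typed missing `3`-part from the refined Kolyvagin
# conjecture on corner frames (`M_∞ = t`) and the twist input, NO STEP L (cell `bsd-stepL`, seat `bsd-stepL-corner-p1` g2; `--supports stmt-BirchSwinnertonDyer-19111`)

File 1/2 (`ClassRecordThreeCornerAtThreeKolyvagin.lean`) proves, from the cited structure facts under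
irreducibility (`Cha2005.rmk25_…`, p422597, flag `Cha05-Rmk25-structure`): §1 at one frame of any odd
multiplicative `p` with `E[p]` irreducible, `M_∞ ≥ t ⟹ ord_p #Ш(E/K) + 2t ≤ 2·ord_p[E(K):ℤP]` and a
level-`(M+1)` certificate with `M ≤ t ⟹ X11b.IndexLowerBoundAt W p K P`; §2 conjunct (U♯) `Three.CornerUpperAt W`
of crux `CornerAtThree` for every `W` modulo J₃ᶜ. THIS FILE:

* §3 `missingPPartAt_three_of_corner_of_refinedKolyvagin_of_cornerTwist` — for `(E,3) ∈` X11b with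
  `ρ̄_{E,3}` NOT onto: `Typed.MissingPPartAt W 3` (`ord₃ #Ш(E) = ord₃ #Ш(E)_an`) from the PUBLISHED facts
  Gross–Zagier, Kolyvagin, GZK, modularity ×2, Hoffstein–Luo, Mazur 1978 Cor. 4.1, Shimura reciprocity at
  conductor `1`, Darmon 2004 Thm. 3.6, the two structure facts, and THREE typed inputs at the pair:
  **Z₃ᶜ** — on every odd Manin-good frame a Kolyvagin certificate of level `M + 1` with
  `M ≤ t = ord₃ ∏_ℓ c_ℓ(E)` (`Koly.CertificateAt`; `M_∞ ≤ t`); **J₃ᶜ** — the Jetchev direction `M_∞ ≥ t` on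
  the same frames; **(Tw)** — x11b3-p8's `Three.CornerTwistAt W` (`BSD(E^{d_K},3)` for the rank-`0` odd
  Heegner twists). NO `CornerStepLAt` (anticyclotomic-IMC currency), NO `CornerUpperAt`, NO control
  identity: on the corner the IMC-type input is REPLACED by the refined Kolyvagin conjecture `M_∞ = t`, a
  statement about `3`-divisibility of derived Heegner points, finitely certifiable per pair (at `t = 0`:
  `c_1(n) ≠ 0` for one Kolyvagin `n`, W. Zhang's form). Chain = x11b3's `missingPPartAt_of_corner_of_inputs`
  (`exists_oddHeegnerData`; lower `missingLowerBoundAt_of_indexLowerBoundAt`; upper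
  `missingUpperBoundAt_of_shaIndexBound_sharp` with weight `t`) with the two `K`-level inputs from file 1 §1.
* §4 `missingPPartAt_three_of_corner_of_refinedKolyvaginFrames` — the corner binders `hCs` ∕ `hCn` of CLASS
  RECORD v4 (`Three.forall_bsdp_of_classRecord`), class-wide, from {Z₃ᶜ, J₃ᶜ, `CornerTwistAt`} quantified
  over the class. File 3/3 (`ClassRecordThreeCornerAtThreeKolyvaginLeaf.lean`) feeds them to the class
  record: CLASS RECORD v4.1 and the K2@3 LEAF `X11b.MultiplicativeRankOneAtThree` with the corner inputs
  `{CornerStepLAt, CornerUpperAt}` REPLACED by `{Z₃ᶜ, J₃ᶜ}`.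

HONEST FRAMING. Z₃ᶜ and J₃ᶜ are hypothesis SHAPES (no `def`, no named fact; the two halves of the refined
Kolyvagin conjecture `M_∞ = t`, Jetchev 2008 Conj. 1.3 ∕ BCGS 2023 Thm. 2 shape — NOT in print at `p ∣ N`
nor for a non-surjective image); (Tw) is x11b3-p8's typed `@[conjecture]` input; the structure facts carry
the referee flag `Cha05-Rmk25-structure`. Item 19111 does NOT close; the K2@3 leaf is untouched; BSD is not
advanced by bookkeeping; O2 OPEN; labels UNCHANGED; no census word moves. CONDITIONAL on every binder.

References: [Cha2005] Thm. 21, Rmk. 25 (pp. 173–175); [MatarNekovar2019] Thm. 0.7, §0.9, §0.11 (pp. 456–457);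
[McCallumLMS1991] §5 Lemma 5.1, Cor. 5.6; [Jetchev2008] Conj. 1.3; [WZhang2014] Thm. 1.1, Rem. 5;
[JetchevSkinnerWan2017] §7.4.1–7.4.2; [Darmon2004] Thm. 3.6; [HoffsteinLuo1997] §1; [Mazur1978] Cor. 4.1;
[Miller2011LMS] Def. 1.1; tree: x11b3 `X11b/Three/{CornerDischarge, CornerResidual, ClassRecordResidual,
ClassRecordAtThree}.lean`, koly `X11b/Three/KolyvaginNonvanishing.lean`.
-/

noncomputable section

open scoped Classical


namespace Summit.BirchSwinnertonDyer.Rank1Residual.X11b.Three.Koly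

open scoped NumberField

open WeierstrassCurve Literature.NumberTheory.EllipticCurves
  Literature.NumberTheory.EllipticCurves.ModularForms
  Literature.NumberTheory.EllipticCurves.Rank1Residual
  Literature.NumberTheory.EllipticCurves.Rank1Residual.Typed
  Literature.NumberTheory.EllipticCurves.Wuthrich2014
  Literature.NumberTheory.GaloisRepresentations Literature.NumberTheory.GaloisCohomology
  Summit.BirchSwinnertonDyer.Rank1Residual Summit.BirchSwinnertonDyer.Rank1Residual.X11b

/-! ### §3 The corner at `3`: `BSD(E,3)`'s typed missing `3`-part from the refined Kolyvagin conjecture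
on corner frames and the twist input — NO STEP L, NO main conjecture, NO control identity -/

/-- **THE (T4″)@3 CORNER ON THE KOLYVAGIN ROAD.** For `(E,3) ∈` X11b with `ρ̄_{E,3}` NOT surjective:
`Typed.MissingPPartAt W 3` (`ord₃ #Ш(E) = ord₃ #Ш(E)_an`) from the PUBLISHED facts Gross–Zagier (`hGZ`),
Kolyvagin (`hKo`), GZK, modularity (`hmod`, `hnf`), Hoffstein–Luo (`hHL`), Mazur 1978 Cor. 4.1 (`hMaz`),
Shimura reciprocity at conductor `1` (`hrec`), Darmon 2004 Thm. 3.6 (`hD36`), the two cited structure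
facts under irreducibility (`hChaL`, `hChaU`; flag `Cha05-Rmk25-structure`), and THREE typed inputs at
the pair: **Z₃ᶜ** (`hZ`) — on every Manin-good frame of the pair over an odd Heegner field there is a
Kolyvagin certificate of some level `M + 1` with `M ≤ t = ord₃ ∏_ℓ c_ℓ(E)` (`Koly.CertificateAt`, i.e.
`M_∞ ≤ t`; at `t = 0` it is Kolyvagin's conjecture `c_1(n) ≠ 0` in W. Zhang's form); **J₃ᶜ** (`hJ`) —
the Jetchev direction `M_∞ ≥ t` on the same frames; **(Tw)** (`hTw`) — `BSD(E^{d_K},3)` for the rank-`0`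
odd Heegner twists (x11b3-p8's `Three.CornerTwistAt W`, by name). Chain: `exists_oddHeegnerData`;
LOWER = `missingLowerBoundAt_of_indexLowerBoundAt` with STEP L in Gross–Zagier currency from the
certificate (§1 lower) and the twist's `≤`-half; UPPER = `missingUpperBoundAt_of_shaIndexBound_sharp`
(weight `w = t`) with the sharpened bound from J₃ᶜ (§1 upper) and the twist's `≥`-half. Compared with
x11b3's `missingPPartAt_of_corner_of_inputs` the inputs (L) `CornerStepLAt` (anticyclotomic-IMC
currency, no print for a Cartan-normaliser image at any `p`) and (U♯) `CornerUpperAt` are REPLACED by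
the refined Kolyvagin conjecture `M_∞ = t` on corner frames — a statement about `3`-divisibility of
derived Heegner points, finitely certifiable per pair. CONDITIONAL on `hZ`, `hJ`, `hTw`, `hChaL`,
`hChaU`; nothing booked; item 19111 does NOT close; O2 OPEN.
[cite: Cha2005, Thm. 21 and Rmk. 25 (pp. 173–175)] [cite: MatarNekovar2019, Thm. 0.7, §0.9, §0.11 (pp. 456–457)]
[cite: McCallumLMS1991, §5 Cor. 5.6 (p. 310) and Lemma 5.1 (p. 303)] [cite: Jetchev2008, Conj. 1.3 (p. 812)]
[cite: WZhang2014, Thm. 1.1 (p. 195) and Remark 5 (p. 199)] [cite: JetchevSkinnerWan2017, §7.4.1–7.4.2 (pp. 30–31)]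
[cite: Darmon2004, Thm. 3.6 (PDF p. 43)] [cite: HoffsteinLuo1997, Theorem (§1)] [cite: Mazur1978, Cor. 4.1]
[cite: Miller2011LMS, Def. 1.1] -/
theorem missingPPartAt_three_of_corner_of_refinedKolyvagin_of_cornerTwist
    (hGZ : ∀ (N : ℕ) [NeZero N] (W : WeierstrassCurve ℚ) (K : Type) [Field K] [NumberField K],
      gross_zagier N W K)
    (hKo : ∀ (N : ℕ) [NeZero N] (W : WeierstrassCurve ℚ) (K : Type) [Field K] [NumberField K],
      kolyvagin N W K)
    (hGZK : rank_eq_analyticRank_of_analyticRank_le_one) (hmod : hasEntireLFunction_rat)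
    (hnf : exists_isNewformOf) (hHL : HoffsteinLuo1997_exists_twist_L_one_ne_zero)
    (hMaz : mazur_not_dvd_maninConstant_of_odd)
    (hrec : ∀ (N : ℕ) [NeZero N] (W : WeierstrassCurve ℚ) (K : Type) [Field K] [NumberField K],
      heegnerPointOfConductor_one_galoisConj N W K)
    (hD36 : ∀ (N : ℕ) [NeZero N] (W : WeierstrassCurve ℚ) (K : Type) [Field K] [NumberField K],
      phi_heegnerTau_mem_singularModuliField N W K)
    (hChaL : Cha2005.rmk25_pow_dvd_card_sha_primary_of_certificate)
    (hChaU : Cha2005.rmk25_padicValNat_card_sha_primary_add_le_of_globalDivisibility)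
    (W : WeierstrassCurve ℚ) [W.IsElliptic] [W.IsGloballyMinimal] (hX : ClassX11b W 3)
    (hns : ¬ Surj W 3)
    -- Z₃ᶜ: a Kolyvagin certificate of level ≤ t + 1 on every odd Manin-good frame of the pair (`M_∞ ≤ t`)
    (hZ : ∀ [NeZero (W.conductorNorm ℤ)] (K : Type) [Field K] [NumberField K]
      (Dt : ModularParametrizationData W (W.conductorNorm ℤ)) (β : ℤ) (ι : K →+* ℂ),
      IsImaginaryQuadratic K → SatisfiesHeegnerHypothesis (W.conductorNorm ℤ) K →
      Odd (NumberField.discr K) →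
      (4 * (W.conductorNorm ℤ : ℤ)) ∣ β ^ 2 - NumberField.discr K → ¬ (3 : ℤ) ∣ Dt.c →
      ∃ M : ℕ, M ≤ padicValNat 3 W.tamagawaProduct ∧ CertificateAt Dt β ι 3 M)
    -- J₃ᶜ: the Jetchev direction on the same frames (`M_∞ ≥ t`)
    (hJ : ∀ [NeZero (W.conductorNorm ℤ)] (K : Type) [Field K] [NumberField K]
      (Dt : ModularParametrizationData W (W.conductorNorm ℤ)) (β : ℤ) (ι : K →+* ℂ),
      IsImaginaryQuadratic K → SatisfiesHeegnerHypothesis (W.conductorNorm ℤ) K →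
      Odd (NumberField.discr K) →
      (4 * (W.conductorNorm ℤ : ℤ)) ∣ β ^ 2 - NumberField.discr K → ¬ (3 : ℤ) ∣ Dt.c →
      ∀ (s : ℕ), s ≤ padicValNat 3 W.tamagawaProduct →
        ∀ (n : ℕ) (d : KolyvaginHeegnerData Dt β ι n), Squarefree n →
          (∀ ℓ ∈ n.primeFactors, Zhang2014.IsKolyvaginPrime (W.conductorNorm ℤ) W K 3 ℓ ∧
            s ≤ Zhang2014.kolyvaginIndex W 3 ℓ) → PDiv d 3 s)
    -- (Tw): `BSD(E^{d_K},3)` for the rank-0 odd Heegner twists (x11b3-p8's typed input, by name)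
    (hTw : CornerTwistAt W) :
    Typed.MissingPPartAt W 3 := by
  haveI : Fact (Nat.Prime 3) := ⟨Nat.prime_three⟩
  have hX' := hX
  obtain ⟨hr, hp2, hmult, hirr⟩ := hX
  haveI : NeZero (W.conductorNorm ℤ) := ⟨(W.conductorNorm_pos_holds).ne'⟩
  obtain ⟨K, _, _, Dt, H, ι, P, Wd, _, _, Cd, hK, hodd, hpd, hHN, hP, hc, hμ, hLt, hWd⟩ :=
    exists_oddHeegnerData hnf hHL hMaz integral_neronScaling_of_isGloballyMinimal_holds W 3 hr hp2
      hmult hirr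
  -- transports to the minimal twist model (image-free)
  have hD0 : (NumberField.discr K : ℚ) ≠ 0 := by exact_mod_cast NumberField.discr_ne_zero K
  haveI hEt : (W.quadraticTwist (NumberField.discr K : ℚ)).IsElliptic :=
    W.isElliptic_quadraticTwist hD0
  have htam : padicValNat 3 Wd.tamagawaProduct = padicValNat 3 W.tamagawaProduct :=
    X2.padicValNat_tamagawaProduct_twist_of_heegner_of_odd W 3 hp2 K hK hodd hpd hHN Cd hWd
  have hu : padicValRat 3 (Cd.u : ℚ) = 0 :=
    padicValRat_u_eq_zero_of_twist_minimal W 3 K hK hHN hmult Cd hWd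
  have hLt' : (W.quadraticTwist (NumberField.discr K : ℚ)).entireLFunction = Wd.entireLFunction := by
    rw [← hWd, entireLFunction_smul]
  have hLd1 : Wd.entireLFunction 1 ≠ 0 := by rw [← hLt']; exact hLt
  have hrd : Wd.analyticRank = 0 := (Wd.analyticRank_eq_zero_iff_holds (hmod Wd)).2 hLd1
  -- the twist's `3`-part from the typed input (Tw), both halves
  obtain ⟨qd, hqd, hvqd⟩ := exists_LOne_div_realPeriodRat_of_bsdp_rankZero hGZK hmod Wd 3 hrd
    (hTw K Wd Cd hX' hns hK hodd hHN hLt hWd)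
  -- the Heegner point has infinite order (Gross–Zagier)
  have hPinf : ¬ IsOfFinAddOrder P :=
    not_isOfFinAddOrder_of_heegner_of_analyticRank_eq_one W _ K Dt H ι P (hGZ _ W K) hmod hr hK hHN
      hLt hP
  -- `d_K ≠ −3, −4`
  have h3 : NumberField.discr K ≠ -3 := by
    intro h; apply hpd; rw [h]; exact ⟨-1, by norm_num⟩
  have h4 : NumberField.discr K ≠ -4 := by
    intro h; have := Int.odd_iff.mp hodd; omega
  -- a conductor-1 Kolyvagin–Heegner datum on the frame (Dt, H.β, ι) and its bottom point `P_1 = P`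
  obtain ⟨d₁⟩ := exists_kolyvaginHeegnerData_one (hD36 _ W K) hK Dt H.β ι H.dvd_sq_sub
  have hPd : d₁.toGeomPoints d₁.derivedPoint = toGeomPoints (W.baseChange K) P :=
    KolyvaginBottom.toGeomPoints_derivedPoint_one_eq (hrec _ W K) hK hHN hP d₁ rfl
  -- no 3-torsion over K (irreducibility)
  have hbot := torsionBy_eq_bot_of_isImaginaryQuadratic_of_hasIrreducibleModPGaloisRep W K hK
    Nat.prime_three hirr
  have hiv : ∀ x : (W.baseChange K).toAffine.Point, 3 • x = 0 → x = 0 := fun x hx ↦ by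
    have hmem : x ∈ AddSubgroup.torsionBy (W.baseChange K).toAffine.Point ((3 : ℕ) : ℤ) := by
      rw [mem_torsionBy_iff, natCast_zsmul]
      exact hx
    rw [hbot] at hmem
    exact hmem
  refine Typed.missingPPartAt_of_lower_of_upper W 3 ?_ ?_
  · -- LOWER half: STEP L in Gross–Zagier currency from the certificate Z₃ᶜ + the twist's `≤`-half
    refine missingLowerBoundAt_of_indexLowerBoundAt W 3 (W.conductorNorm ℤ) K Dt H ι P (hGZ _ W K)
      (hKo _ W K) hGZK hmod hK hHN hP hp2 hc hμ hr hLt Wd Cd hWd hu htam ⟨qd, hqd, hvqd.symm.le⟩ ?_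
    intro hfinK
    haveI : Finite (W.baseChange K).sha := hfinK
    obtain ⟨hrank, -⟩ := hKo (W.conductorNorm ℤ) W K hK hHN ⟨Dt, H, ι, hP⟩ hPinf
    obtain ⟨M, hMt, hcert⟩ := hZ K Dt H.β ι hK hHN hodd H.dvd_sq_sub hc
    exact indexLowerBoundAt_of_certificateAt_of_irreducible hChaL W K 3 hp2 hmult hirr hK h3 h4 hHN Dt
      H.β ι d₁ P hPd hPinf hrank hiv hcert hMt
  · -- UPPER half: the SHARPENED bound over K from J₃ᶜ (weight t) + the twist's `≥`-half
    refine missingUpperBoundAt_of_shaIndexBound_sharp W 3 (W.conductorNorm ℤ) K Dt H ι P (hGZ _ W K)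
      (hKo _ W K) hGZK hmod hK hHN hP hp2 hc hμ hr hLt Wd Cd hWd hu htam le_rfl ⟨qd, hqd, hvqd.le⟩ ?_
    intro hfinK _
    haveI : Finite (W.baseChange K).sha := hfinK
    obtain ⟨hrank, -⟩ := hKo (W.conductorNorm ℤ) W K hK hHN ⟨Dt, H, ι, hP⟩ hPinf
    exact shaIndexBound_sharp_of_globalDivisibility_of_irreducible hChaU W K 3 hp2 hmult hirr hK h3 h4
      hHN Dt H.β ι d₁ P hPd hPinf hrank hiv (hJ K Dt H.β ι hK hHN hodd H.dvd_sq_sub hc)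


/-! ### §4 The class record's corner binders `hCs` ∕ `hCn` (v4, `Three.forall_bsdp_of_classRecord`) on the
Kolyvagin road -/

/-- **The corner binders of CLASS RECORD v4 (`hCs`: corner ∧ split(3); `hCn`: corner ∧ nonsplit(3)) from
the refined Kolyvagin conjecture on corner frames + the twist input**, class-wide: for every `(E,3) ∈`
X11b with `ρ̄_{E,3}` NOT onto, `Typed.MissingPPartAt W 3` — `missingPPartAt_three_of_corner_of_refinedKolyvagin_of_cornerTwist`
with its three typed inputs quantified over the class (Z₃ᶜ `hZ`, J₃ᶜ `hJ`, (Tw) `hCT` = x11b3-p8's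
`Three.CornerTwistAt` by name); the antecedents `3 ∣ ord₃ Δ_min`, `¬Ram`, split ∕ nonsplit of the v4
binders are not used (automatic ∕ irrelevant on the corner). Feeding these two terms to
`Three.forall_bsdp_of_classRecord` in place of x11b3's `missingPPartAt_of_corner_{split,nonsplit}_of_inputs`
gives CLASS RECORD v4.1 with the corner's inputs `{CornerStepLAt, CornerTwistAt, CornerUpperAt}` replaced by
`{Z₃ᶜ, J₃ᶜ, CornerTwistAt}`. CONDITIONAL on every binder; nothing booked; O2 OPEN.
[cite: Cha2005, Rmk. 25 (p. 175)] [cite: McCallumLMS1991, §5 Cor. 5.6 (p. 310)] [cite: Miller2011LMS, Def. 1.1] -/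
theorem missingPPartAt_three_of_corner_of_refinedKolyvaginFrames
    (hGZ : ∀ (N : ℕ) [NeZero N] (W : WeierstrassCurve ℚ) (K : Type) [Field K] [NumberField K],
      gross_zagier N W K)
    (hKo : ∀ (N : ℕ) [NeZero N] (W : WeierstrassCurve ℚ) (K : Type) [Field K] [NumberField K],
      kolyvagin N W K)
    (hGZK : rank_eq_analyticRank_of_analyticRank_le_one) (hmod : hasEntireLFunction_rat)
    (hnf : exists_isNewformOf) (hHL : HoffsteinLuo1997_exists_twist_L_one_ne_zero)
    (hMaz : mazur_not_dvd_maninConstant_of_odd)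
    (hrec : ∀ (N : ℕ) [NeZero N] (W : WeierstrassCurve ℚ) (K : Type) [Field K] [NumberField K],
      heegnerPointOfConductor_one_galoisConj N W K)
    (hD36 : ∀ (N : ℕ) [NeZero N] (W : WeierstrassCurve ℚ) (K : Type) [Field K] [NumberField K],
      phi_heegnerTau_mem_singularModuliField N W K)
    (hChaL : Cha2005.rmk25_pow_dvd_card_sha_primary_of_certificate)
    (hChaU : Cha2005.rmk25_padicValNat_card_sha_primary_add_le_of_globalDivisibility)
    -- Z₃ᶜ on every corner frame of the class
    (hZ : ∀ (W : WeierstrassCurve ℚ) [W.IsElliptic] [W.IsGloballyMinimal] [NeZero (W.conductorNorm ℤ)]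
      (K : Type) [Field K] [NumberField K]
      (Dt : ModularParametrizationData W (W.conductorNorm ℤ)) (β : ℤ) (ι : K →+* ℂ),
      ClassX11b W 3 → ¬ Surj W 3 →
      IsImaginaryQuadratic K → SatisfiesHeegnerHypothesis (W.conductorNorm ℤ) K →
      Odd (NumberField.discr K) →
      (4 * (W.conductorNorm ℤ : ℤ)) ∣ β ^ 2 - NumberField.discr K → ¬ (3 : ℤ) ∣ Dt.c →
      ∃ M : ℕ, M ≤ padicValNat 3 W.tamagawaProduct ∧ CertificateAt Dt β ι 3 M)
    -- J₃ᶜ on every corner frame of the class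
    (hJ : ∀ (W : WeierstrassCurve ℚ) [W.IsElliptic] [W.IsGloballyMinimal] [NeZero (W.conductorNorm ℤ)]
      (K : Type) [Field K] [NumberField K]
      (Dt : ModularParametrizationData W (W.conductorNorm ℤ)) (β : ℤ) (ι : K →+* ℂ),
      ClassX11b W 3 → ¬ Surj W 3 →
      IsImaginaryQuadratic K → SatisfiesHeegnerHypothesis (W.conductorNorm ℤ) K →
      Odd (NumberField.discr K) →
      (4 * (W.conductorNorm ℤ : ℤ)) ∣ β ^ 2 - NumberField.discr K → ¬ (3 : ℤ) ∣ Dt.c →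
      ∀ (s : ℕ), s ≤ padicValNat 3 W.tamagawaProduct →
        ∀ (n : ℕ) (d : KolyvaginHeegnerData Dt β ι n), Squarefree n →
          (∀ ℓ ∈ n.primeFactors, Zhang2014.IsKolyvaginPrime (W.conductorNorm ℤ) W K 3 ℓ ∧
            s ≤ Zhang2014.kolyvaginIndex W 3 ℓ) → PDiv d 3 s)
    -- (Tw) by name
    (hCT : ∀ (W : WeierstrassCurve ℚ) [W.IsElliptic] [W.IsGloballyMinimal], CornerTwistAt W) :
    ∀ (W : WeierstrassCurve ℚ) [W.IsElliptic] [W.IsGloballyMinimal],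
      ClassX11b W 3 → ¬ Surj W 3 → Typed.MissingPPartAt W 3 :=
  fun W _ _ hX hns ↦
    missingPPartAt_three_of_corner_of_refinedKolyvagin_of_cornerTwist hGZ hKo hGZK hmod hnf hHL hMaz hrec
      hD36 hChaL hChaU W hX hns
      (fun K _ _ Dt β ι hK hHN hodd hβ hc ↦ hZ W K Dt β ι hX hns hK hHN hodd hβ hc)
      (fun K _ _ Dt β ι hK hHN hodd hβ hc ↦ hJ W K Dt β ι hX hns hK hHN hodd hβ hc) (hCT W)

end Summit.BirchSwinnertonDyer.Rank1Residual.X11b.Three.Koly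

end
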